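/-
Copyright (c) 2026 the pub-hodgecm-mathlib formalisation cell (harness21).  Prover seat hodgecm-mathlib-K2E4-p13 (g0),
Track B «K2-LIT» ∕ h413, ENGINE E4 unit U6 `ArchLimitConstant` — the H-STEP LAW `hH` of K2E4-p09's #9 assembly BY ITS EXACT TEXT (`K2/K2E4-p09/g0/HSTEP.sig.txt`).  2026-09-03.
-/
import Literature.NumberTheory.Automorphic.ArchEndoscopicCentralDescentValue     -- ★ p854868 ED. 3 §5: `exists_const_tendsto_deriv_two_sin_smul_sum_integral_pi` (general 2-block weights `α`)
import Literature.NumberTheory.Automorphic.ArchEndoscopicDiagonalCongruence      -- ★ (R3-a): the endoscopic weights `β₂ = (½, −½)`: `quasiSplitWeightsTwo_ne_zero`, `im_embedding_…_eq_zero`, `re_embedding_…_mul_neg`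
import HarnessLib

/-!
# K2 · E4 · U6: the H-STEP LAW of the #9 assembly, in the assembler's exact binder shape (`hH` of `explicitArchSingularTransfer_of_packages`)

Cell `pub/hodgecm-mathlib` (D-0151), HCML Track B, crux H413 = `stmt-HodgeConjecture-24833`; socket #9 `sig_K2E4ExplicitArchSingularTransfer` of
`Cruxes/H413/Lines/K2_E4_SingularTransferKappaSignSigsArchLimitConstant.lean` (assembler K2E4-p09, skeleton `K2E4ExplicitArchSingularTransferOfPackages.skel.v1` sha16 0488ad9d27addf63,
2026-09-03T21:28:23Z).  The skeleton's head takes two hypotheses, `hH` (the H-side one-step law at the endoscopic 2-block weights `β₂ = (½, −½)`, per place, `∃ C ≠ 0`, filter `𝓝[≠] 0`) and `hG`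
(K2E4-p11's G′ package).  THIS FILE discharges `hH` BY ITS EXACT TEXT: **`hStepLaw`** has the type of `hH` token for token (sliced from `K2/K2E4-p09/g0/HSTEP.sig.txt`), proved by ★ p854868 §5
`exists_const_tendsto_deriv_two_sin_smul_sum_integral_pi` at `α := β₂` (★ `UnitaryGroup.quasiSplitWeightsTwo_ne_zero`, ★ `im_embedding_quasiSplitWeightsTwo_eq_zero`, ★
`re_embedding_quasiSplitWeightsTwo_mul_neg`), dropping the differentiability conjunct.  So the assembler writes `explicitArchSingularTransfer_of_packages hStepLaw hG`.
HONEST LABEL: HC_CM is proved only modulo the 7 printed citations (2 remaining named inputs: hLiu418 = stmt-HodgeConjecture-24832, h413 = stmt-HodgeConjecture-24833) until rung 0 closes;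
plumbing over ★ p854868, pays no socket by itself.

## References
* [Rogawski1990] J. D. Rogawski, *Automorphic Representations of Unitary Groups in Three Variables*, Ann. of Math. Stud. 123 (1990), §8.2 Prop. 8.2.1 pp. 118–119; §14.5 Lemma 14.5.2 (b)(c) p. 238.
* [Varadarajan1989] V. S. Varadarajan, *An Introduction to Harmonic Analysis on Semisimple Lie Groups* (1989), §6.4 Thm. 22.
-/

set_option autoImplicit false

noncomputable section

open MeasureTheory NumberField NumberField.InfinitePlace Filter Topology
open scoped MatrixGroups ContDiff Classical
-- the scoped `L^∞`-operator norm on `M_N(L ⊗ ℝ)`, the cell's ambient-smooth convention (★ V1 ∕ ★ (E2))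
open scoped Matrix.Norms.Operator

namespace Summit.HodgeConjecture.HodgeConjecture.Cruxes.H413.K2E4ArchHStepLaw

open Literature.NumberTheory.Automorphic

/-- **THE H-STEP LAW `hH` OF THE #9 ASSEMBLY, EXACT TEXT** (K2E4-p09 `HSTEP.sig.txt`): for every CM field `L`, at the endoscopic 2-block weights `β₂ = (½, −½)` (so `U(β₂)_w ≅ U(1,1)` at every
complex place), for all orbit σ-algebras, Haar measures `νw`, central angles `z` and every place `w₁`: ONE constant `C ≠ 0` with
`∂_ψ[2 sin ψ • Σ_ε ∫ Θ d(⊗ M(S, u[w₁ ↦ (z e^{iψ}, z e^{−iψ})], ε))] → C • Σ_ε ∫ Θ d(⊗ M(S ∖ w₁, u, ε))` along `𝓝[≠] 0` for every smooth compactly supported `Θ`, `S ∋ w₁`, `u` regular on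
`S ∖ w₁` — ★ `exists_const_tendsto_deriv_two_sin_smul_sum_integral_pi` (Harish-Chandra's rank-one limit formula, descended) at `α := β₂`.
[cite: Rogawski1990, §8.2 Prop. 8.2.1 pp. 118–119; §14.5 Lemma 14.5.2 (b)(c) p. 238] [cite: Varadarajan1989, §6.4 Thm. 22] -/
theorem hStepLaw (L : Type) [Field L] [NumberField L] [IsCMField L] :
    ∀ [∀ w : {w : InfinitePlace L // IsComplex w}, MeasurableSpace (UnitaryGroup.archLocal L 2 (Matrix.diagonal ![(2 : L)⁻¹, -(2 : L)⁻¹]) w)]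
        [∀ w : {w : InfinitePlace L // IsComplex w}, BorelSpace (UnitaryGroup.archLocal L 2 (Matrix.diagonal ![(2 : L)⁻¹, -(2 : L)⁻¹]) w)]
        (νw : ∀ w : {w : InfinitePlace L // IsComplex w}, Measure (UnitaryGroup.archLocal L 2 (Matrix.diagonal ![(2 : L)⁻¹, -(2 : L)⁻¹]) w)) [∀ w, (νw w).IsHaarMeasure]
        (z : {w : InfinitePlace L // IsComplex w} → Circle) (w₁ : {w : InfinitePlace L // IsComplex w}),
        ∃ C : ℝ, C ≠ 0 ∧ ∀ (Θ : Matrix (Fin 2) (Fin 2) (mixedEmbedding.mixedSpace L) → ℂ), ContDiff ℝ (⊤ : ℕ∞) Θ →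
          HasCompactSupport (fun g : UnitaryGroup.arch (↥(maximalRealSubfield L)) L (IsCMField.complexConj L) 2 (Matrix.diagonal ![(2 : L)⁻¹, -(2 : L)⁻¹]) =>
            Θ ((g : GL (Fin 2) (mixedEmbedding.mixedSpace L)) : Matrix (Fin 2) (Fin 2) (mixedEmbedding.mixedSpace L))) →
          ∀ (S : Finset {w : InfinitePlace L // IsComplex w}), w₁ ∈ S → ∀ (u : {w : InfinitePlace L // IsComplex w} → Fin 2 → Circle), (∀ w ∈ S, w ≠ w₁ → u w 0 ≠ u w 1) →
          Tendsto (fun ψ : ℝ => deriv (fun ψ : ℝ => (2 * Real.sin ψ) • ∑ ε : {w : InfinitePlace L // IsComplex w} → Bool,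
              ∫ o, Θ (((((UnitaryGroup.archPiEquivCM 2 L (Matrix.diagonal ![(2 : L)⁻¹, -(2 : L)⁻¹])).symm o) :
                  UnitaryGroup.arch (↥(maximalRealSubfield L)) L (IsCMField.complexConj L) 2 (Matrix.diagonal ![(2 : L)⁻¹, -(2 : L)⁻¹])) : GL (Fin 2) (mixedEmbedding.mixedSpace L)) :
                  Matrix (Fin 2) (Fin 2) (mixedEmbedding.mixedSpace L))
                ∂(Measure.pi (fun w : {w : InfinitePlace L // IsComplex w} =>
                  if w ∈ S then (νw w).map (fun g : UnitaryGroup.archLocal L 2 (Matrix.diagonal ![(2 : L)⁻¹, -(2 : L)⁻¹]) w =>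
                    g * ⟨UnitaryGroup.circleDiagonal 2 (if ε w then (Function.update u w₁ ![z w₁ * Circle.exp ψ, z w₁ * Circle.exp (-ψ)]) w ∘ ⇑(Equiv.swap (0 : Fin 2) 1)
                      else (Function.update u w₁ ![z w₁ * Circle.exp ψ, z w₁ * Circle.exp (-ψ)]) w),
                      UnitaryGroup.circleDiagonal_mem_archLocal_diagonal L 2 ![(2 : L)⁻¹, -(2 : L)⁻¹] w _⟩ * g⁻¹)
                  else Measure.dirac (⟨UnitaryGroup.circleDiagonal 2 ![z w, z w], UnitaryGroup.circleDiagonal_mem_archLocal_diagonal L 2 ![(2 : L)⁻¹, -(2 : L)⁻¹] w _⟩ :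
                    UnitaryGroup.archLocal L 2 (Matrix.diagonal ![(2 : L)⁻¹, -(2 : L)⁻¹]) w)))) ψ)
            (𝓝[≠] 0)
            (𝓝 (C • ∑ ε : {w : InfinitePlace L // IsComplex w} → Bool,
              ∫ o, Θ (((((UnitaryGroup.archPiEquivCM 2 L (Matrix.diagonal ![(2 : L)⁻¹, -(2 : L)⁻¹])).symm o) :
                  UnitaryGroup.arch (↥(maximalRealSubfield L)) L (IsCMField.complexConj L) 2 (Matrix.diagonal ![(2 : L)⁻¹, -(2 : L)⁻¹])) : GL (Fin 2) (mixedEmbedding.mixedSpace L)) :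
                  Matrix (Fin 2) (Fin 2) (mixedEmbedding.mixedSpace L))
                ∂(Measure.pi (fun w : {w : InfinitePlace L // IsComplex w} =>
                  if w ∈ S.erase w₁ then (νw w).map (fun g : UnitaryGroup.archLocal L 2 (Matrix.diagonal ![(2 : L)⁻¹, -(2 : L)⁻¹]) w =>
                    g * ⟨UnitaryGroup.circleDiagonal 2 (if ε w then u w ∘ ⇑(Equiv.swap (0 : Fin 2) 1) else u w),
                      UnitaryGroup.circleDiagonal_mem_archLocal_diagonal L 2 ![(2 : L)⁻¹, -(2 : L)⁻¹] w _⟩ * g⁻¹)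
                  else Measure.dirac (⟨UnitaryGroup.circleDiagonal 2 ![z w, z w], UnitaryGroup.circleDiagonal_mem_archLocal_diagonal L 2 ![(2 : L)⁻¹, -(2 : L)⁻¹] w _⟩ :
                    UnitaryGroup.archLocal L 2 (Matrix.diagonal ![(2 : L)⁻¹, -(2 : L)⁻¹]) w))))) := by
  intro _ _ νw _ z w₁
  obtain ⟨C, hC, h⟩ := UnitaryGroup.exists_const_tendsto_deriv_two_sin_smul_sum_integral_pi (E := ℂ) L ![(2 : L)⁻¹, -(2 : L)⁻¹] νw z
    (UnitaryGroup.quasiSplitWeightsTwo_ne_zero (L := L)) w₁ (UnitaryGroup.im_embedding_quasiSplitWeightsTwo_eq_zero L w₁) (UnitaryGroup.re_embedding_quasiSplitWeightsTwo_mul_neg L w₁)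
  exact ⟨C, hC, fun Θ hΘ hΘc S hw₁ u hu => (h Θ hΘ hΘc S hw₁ u hu).2⟩

end Summit.HodgeConjecture.HodgeConjecture.Cruxes.H413.K2E4ArchHStepLaw

end
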